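import Summits.CriticalPhenomena.PercolationContinuityZ3.Theorems.Transplant.AutChartOrbitsCayleyCosets
import Mathlib.GroupTheory.GroupAction.ConjAct
import Mathlib.GroupTheory.OrderOfElement
import HarnessLib

/-!
# EVERY finitely generated group that VIRTUALLY maps onto a rank-two subgroup of `ℤ²` has Cayley graphs — cofinally many generating sets — with
# `p_c < 1` and `θ(p_c) = 0`: the orbit theorem on the cosets of the normal core, with conjugate "lamp letters" of large scale (UNCONDITIONAL)

builds on p205010 (kernel theorem, internal audit signed; external expert review pending): the theorem runs through `CayleyCosets.conj4_of_cosetLetters_maxArea`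
(«AutChartOrbitsCayleyCosets» p580600), i.e. through the (N3-a) orbit theorem («AutChartOrbitsCriticalContinuity» p493117) and so through p205010.  Lane
`prim-bschramm`, seat `prim-bschramm-p3` gen 34 (DESIGN OWNER; `P3-NILPOTENT.md` §27, offer (O4): the theorem behind the located item L-p3g34-1).  Helper file
(`--supports stmt-CriticalPhenomena-4575 --as helper`); PROOFS ONLY (def-free); no `@[conjecture]` is declared, edited or claimed; NOTHING is claimed about the
end-state node `BenjaminiSchramm1996_conj4_endState` or about Conjecture 4 for a PRESCRIBED generating set.

THE THEOREM (`CayleyVirtualRank.exists_gens_conj4`).  `Γ` a group, `A ≤ Γ` of finite index, `ψ : A → ℤ²` a homomorphism with two independent values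
(`vb₁(Γ) ≥ 2` in the lane's words), `S₀` ANY finite generating set.  Then there is a finite `S ⊇ S₀` (namely `S₀` together with the conjugates
`γ⁻¹ zᵢ^m γ`, `γ` running over a transversal of the normal core `N` of `A`, `z₀, z₁ ∈ N` with independent values, `m` large) such that `Cay(Γ; S)` has
`p_c < 1` and `θ_g(p_c) = 0` at every vertex.  PROOF.  `N ⊴ Γ` has finite index and `ψ|_N` still has rank two (`a^{[Γ:N]} ∈ N`).  The conjugation values
`V = {ψ(δ zᵢ δ⁻¹) : δ ∈ Γ, i}` form a FINITE subset of `ℤ²` (the value depends on `δN` only: `ψ ∘ conj_δ` kills commutators) of rank two; let `(u, v)` be a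
max-area pair of `V` (`MaxArea.exists_maxPair`), so that every `± x`, `x ∈ V`, lies in the closed parallelogram `|det(x, v)|, |det(u, x)| ≤ |det(u, v)|`.  Let
`W₀` be the finite set of `ψ`-values of the `S₀`-letters read on a transversal `R` of `N` (`r·x = a·r′ ⇒ ψ a ∈ W₀`) and `m := 1 + Σ_{w ∈ W₀} (|det(w,v)| + |det(u,w)|)`.
At a representative `r` the letter `x = γ⁻¹ zᵢ^m γ` gives `r·x = (rγ⁻¹ zᵢ^m (rγ⁻¹)⁻¹)·r` with value `m·ψ(conj_{rγ⁻¹} zᵢ)`, and `rγ⁻¹N` runs through ALL cosets as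
`γ` runs through the transversal — so at EVERY `r` the exact values `± m u`, `± m v` are single letters, every lamp-letter value lies in `± mV ⊆` the
parallelogram of `(mu, mv)`, and every `S₀`-letter value `w` has `|det(w, mv)| = m|det(w, v)| ≤ m² |det(u, v)|`: these are `hstep` / `hlip` of the coset
front-end's max-area form.  ∎  WORDS (refuter clause-reads): Conjecture 4's conclusion holds on a COFINAL family of Cayley graphs of every finitely generated
group that virtually surjects onto `ℤ²` — whatever its growth (Bartholdi–Erschler's intermediate-growth `ℤ^k ≀_X 𝔊_ω`, `(ℤ² ≀_X 𝔊) ⋊ C₂` with `b₁ = 0`, `K ⋊ F`, …);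
when `b₁(Γ) ≥ 2` the lane's U_s gives EVERY generating set; what this file does NOT give is a prescribed generating set (e.g. Bartholdi–Erschler's standard
generating set of `ℤ ≀_X 𝔊`, `P3-NILPOTENT.md` §26.7/§27.3) — `θ(p_c) = 0` is not known to be independent of the generating set.
[cite: BenjaminiSchramm1996, Conj. 4; §2 (Cayley graphs)] [cite: KozmaNitzan2024, §4 p. 16 (Lemma 8: max-area coordinates)] [cite: MartineauTassion2017, §3.2]
-/

noncomputable section

namespace Summit.CriticalPhenomena.PercolationContinuityZ3.Theorems.Transplant

open SimpleGraph Literature.Probability.Percolation Literature.Probability.LatticeModels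
open scoped Classical

namespace CayleyVirtualRank

variable {Γ : Type} [Group Γ]

/-! ## §1 Conjugation values of a character of a normal subgroup -/

section Values

variable (N : Subgroup Γ) [nN : N.Normal] (ψ : N →* Multiplicative (Site 2))

/-- **The conjugation value depends only on the coset**: `ψ((δn) z (δn)⁻¹) = ψ(δ z δ⁻¹)` for `n ∈ N` (`ψ ∘ conj_δ` is a homomorphism to an abelian group,
so it kills the commutator of `n` and `z`). [folklore] -/
theorem toAdd_conjNormal_mul_mem (δ : Γ) {n : Γ} (hn : n ∈ N) (z : N) :
    Multiplicative.toAdd (ψ (MulAut.conjNormal (δ * n) z)) = Multiplicative.toAdd (ψ (MulAut.conjNormal δ z)) := by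
  rw [map_mul, MulAut.mul_apply]
  have h : MulAut.conjNormal n z = ⟨n, hn⟩ * z * ⟨n, hn⟩⁻¹ :=
    Subtype.ext (by rw [MulAut.conjNormal_apply, Subgroup.coe_mul, Subgroup.coe_mul, Subgroup.coe_inv])
  rw [h]
  simp only [map_mul, map_inv, toAdd_mul, toAdd_inv]
  abel

/-- The conjugation value at `δ = 1` is the value. [folklore] -/
theorem toAdd_conjNormal_one (z : N) : Multiplicative.toAdd (ψ (MulAut.conjNormal (1 : Γ) z)) = Multiplicative.toAdd (ψ z) := by
  rw [map_one, MulAut.one_apply]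

/-- The conjugation value of a power is the multiple. [folklore] -/
theorem toAdd_conjNormal_pow (δ : Γ) (z : N) (m : ℕ) :
    Multiplicative.toAdd (ψ (MulAut.conjNormal δ (z ^ m))) = (m : ℤ) • Multiplicative.toAdd (ψ (MulAut.conjNormal δ z)) := by
  rw [map_pow, map_pow, toAdd_pow, natCast_zsmul]

end Values

/-! ## §2 A transversal of a normal finite-index subgroup -/

/-- **A finite right transversal** of a normal subgroup of finite index: cosets met exactly once, every element `a·r`. [folklore] -/
theorem exists_transversal (N : Subgroup Γ) [N.Normal] [N.FiniteIndex] :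
    ∃ R : Finset Γ, (∀ r ∈ R, ∀ r' ∈ R, ∀ a : N, (a : Γ) * r = r' → r = r') ∧ (∀ g : Γ, ∃ a : N, ∃ r ∈ R, (a : Γ) * r = g) := by
  set R : Finset Γ := (Set.finite_range fun q : Γ ⧸ N => (q.out)⁻¹).toFinset with hR
  have hmem : ∀ {r : Γ}, r ∈ R ↔ ∃ q : Γ ⧸ N, (q.out)⁻¹ = r := fun {r} => by rw [hR, Set.Finite.mem_toFinset, Set.mem_range]
  refine ⟨R, fun r hr r' hr' a h => ?_, fun g => ?_⟩
  · obtain ⟨q, rfl⟩ := hmem.1 hr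
    obtain ⟨q', rfl⟩ := hmem.1 hr'
    have h1 : q'.out = q.out * (a : Γ)⁻¹ := by
      have := congrArg (·⁻¹) h
      simp only [mul_inv_rev, inv_inv] at this
      exact this.symm
    have h2 : (QuotientGroup.mk q'.out : Γ ⧸ N) = QuotientGroup.mk q.out := by
      rw [h1, QuotientGroup.mk_mul_of_mem _ (N.inv_mem a.2)]
    rw [QuotientGroup.out_eq', QuotientGroup.out_eq'] at h2
    rw [h2]
  · obtain ⟨h, hh⟩ := QuotientGroup.mk_out_eq_mul N g⁻¹
    refine ⟨⟨g * (QuotientGroup.mk (g⁻¹) : Γ ⧸ N).out, by rw [hh, mul_inv_cancel_left]; exact h.2⟩, ((QuotientGroup.mk (g⁻¹) : Γ ⧸ N).out)⁻¹,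
      hmem.2 ⟨_, rfl⟩, ?_⟩
    exact mul_inv_cancel_right g _

/-! ## §3 The theorem for a NORMAL finite-index subgroup with a rank-two character -/

/-- **NORMAL CASE.**  `N ⊴ Γ` of finite index, `ψ : N → ℤ²` with independent values at `z 0, z 1 ∈ N`, `S₀` any finite generating set ⟹ a finite `S ⊇ S₀`
with `p_c(Cay(Γ;S)) < 1 ∧ θ_g(p_c) = 0` at every `g` — `S = S₀ ∪ {γ⁻¹ (z i)^m γ}` over a transversal, `m` large; the coset front-end's max-area form on the
cosets of `N`.  builds on p205010 (kernel theorem, internal audit signed; external expert review pending).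
[cite: BenjaminiSchramm1996, Conj. 4; §2 (Cayley graphs)] [cite: KozmaNitzan2024, §4 p. 16 (Lemma 8: max-area coordinates)] -/
theorem exists_gens_conj4_of_normal (N : Subgroup Γ) [N.Normal] [N.FiniteIndex] (ψ : N →* Multiplicative (Site 2)) (z : Fin 2 → N)
    (hz : MaxArea.det2 (Multiplicative.toAdd (ψ (z 0))) (Multiplicative.toAdd (ψ (z 1))) ≠ 0) (S₀ : Finset Γ)
    (hS₀ : Subgroup.closure (↑S₀ : Set Γ) = ⊤) :
    ∃ S : Finset Γ, S₀ ⊆ S ∧ Subgroup.closure (↑S : Set Γ) = ⊤ ∧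
      ∀ g : Γ, criticalProb (mulCayley (↑S : Set Γ)) g < 1 ∧ theta (mulCayley (↑S : Set Γ)) g (criticalProbIOf (mulCayley (↑S : Set Γ)) g) = 0 := by
  -- conjugation values and their finite set `V`
  let val : Γ → Fin 2 → Site 2 := fun δ i => Multiplicative.toAdd (ψ (MulAut.conjNormal δ (z i)))
  have hval : ∀ (δ : Γ) {n : Γ}, n ∈ N → ∀ i, val (δ * n) i = val δ i := fun δ n hn i => toAdd_conjNormal_mul_mem N ψ δ hn (z i)
  set V : Finset (Site 2) := (Set.finite_range fun p : (Γ ⧸ N) × Fin 2 => val p.1.out p.2).toFinset with hV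
  have hVmem : ∀ (δ : Γ) (i : Fin 2), val δ i ∈ V := by
    intro δ i
    rw [hV, Set.Finite.mem_toFinset, Set.mem_range]
    obtain ⟨h, hh⟩ := QuotientGroup.mk_out_eq_mul N δ
    exact ⟨((QuotientGroup.mk δ : Γ ⧸ N), i), by change val _ i = val δ i; rw [hh, hval δ h.2]⟩
  have hVex : ∀ {x : Site 2}, x ∈ V → ∃ (δ : Γ) (i : Fin 2), val δ i = x := by
    intro x hx
    rw [hV, Set.Finite.mem_toFinset, Set.mem_range] at hx
    obtain ⟨p, hp⟩ := hx
    exact ⟨p.1.out, p.2, hp⟩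
  -- a max-area pair `(u, v)` of `V`
  have hV2 : ∃ u ∈ V, ∃ v ∈ V, MaxArea.det2 u v ≠ 0 := by
    refine ⟨val 1 0, hVmem 1 0, val 1 1, hVmem 1 1, ?_⟩
    change MaxArea.det2 (Multiplicative.toAdd (ψ (MulAut.conjNormal (1 : Γ) (z 0)))) (Multiplicative.toAdd (ψ (MulAut.conjNormal (1 : Γ) (z 1)))) ≠ 0
    rwa [toAdd_conjNormal_one, toAdd_conjNormal_one]
  obtain ⟨u, hu, v, hv, huv, hmax⟩ := MaxArea.exists_maxPair V hV2
  obtain ⟨δ₀, i₀, hδ₀⟩ := hVex hu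
  obtain ⟨δ₁, i₁, hδ₁⟩ := hVex hv
  -- a transversal `R` of `N`
  obtain ⟨R, hRt, hRc⟩ := exists_transversal N
  -- the values of the `S₀`-letters on the transversal and the scale `m`
  let wval : Γ × Γ × Γ → Site 2 := fun t => if h : t.1 * t.2.2 * t.2.1⁻¹ ∈ N then Multiplicative.toAdd (ψ ⟨_, h⟩) else 0
  set W₀ : Finset (Site 2) := (R ×ˢ (R ×ˢ (S₀ ∪ S₀.image fun x => x⁻¹))).image wval with hW₀
  set m : ℕ := 1 + ∑ w ∈ W₀, ((MaxArea.det2 w v).natAbs + (MaxArea.det2 u w).natAbs) with hm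
  have hm1 : 1 ≤ m := by rw [hm]; omega
  have hmW : ∀ w ∈ W₀, (MaxArea.det2 w v).natAbs ≤ m ∧ (MaxArea.det2 u w).natAbs ≤ m := by
    intro w hw
    have h : (MaxArea.det2 w v).natAbs + (MaxArea.det2 u w).natAbs ≤ ∑ w ∈ W₀, ((MaxArea.det2 w v).natAbs + (MaxArea.det2 u w).natAbs) :=
      Finset.single_le_sum (f := fun w => (MaxArea.det2 w v).natAbs + (MaxArea.det2 u w).natAbs) (fun _ _ => Nat.zero_le _) hw
    constructor <;> omega
  -- the lamp letters and the generating set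
  let lampLetter : (Γ ⧸ N) × Fin 2 → Γ := fun p => (p.1.out)⁻¹ * ((z p.2 : N) : Γ) ^ m * p.1.out
  set L : Finset Γ := (Set.finite_range lampLetter).toFinset with hL
  have hLmem : ∀ {y : Γ}, y ∈ L ↔ ∃ p : (Γ ⧸ N) × Fin 2, lampLetter p = y := fun {y} => by rw [hL, Set.Finite.mem_toFinset, Set.mem_range]
  set S : Finset Γ := S₀ ∪ L with hS
  have hS₀S : S₀ ⊆ S := Finset.subset_union_left
  have hSgen : Subgroup.closure (↑S : Set Γ) = ⊤ :=
    eq_top_iff.2 (hS₀ ▸ Subgroup.closure_mono (by exact_mod_cast hS₀S))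
  refine ⟨S, hS₀S, hSgen, fun g => ?_⟩
  -- the step values `b = (m u, m v)`
  let b : Fin 2 → Site 2 := fun i => if i = 0 then (m : ℤ) • u else (m : ℤ) • v
  have hb0 : b 0 = (m : ℤ) • u := rfl
  have hb1 : b 1 = (m : ℤ) • v := rfl
  have hdetb : MaxArea.det2 (b 0) (b 1) = (m : ℤ) * (m : ℤ) * MaxArea.det2 u v := by
    rw [hb0, hb1, MaxArea.det2, MaxArea.det2]
    simp only [Pi.smul_apply, smul_eq_mul]
    ring
  have hm0 : (m : ℤ) ≠ 0 := by exact_mod_cast (show m ≠ 0 by omega)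
  have hb : MaxArea.det2 (b 0) (b 1) ≠ 0 := by rw [hdetb]; exact mul_ne_zero (mul_ne_zero hm0 hm0) huv
  -- (i) conjugates by elements of `N·r`: at `r`, the letter `γ⁻¹ (z i)^m γ` has value `m · val (rγ⁻¹) i`
  have conj_mem : ∀ (r γ : Γ) (i : Fin 2), r * (γ⁻¹ * ((z i : N) : Γ) ^ m * γ) * r⁻¹ ∈ N := by
    intro r γ i
    have e : r * (γ⁻¹ * ((z i : N) : Γ) ^ m * γ) * r⁻¹ = (r * γ⁻¹) * ((z i : N) : Γ) ^ m * (r * γ⁻¹)⁻¹ := by group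
    rw [e]
    exact ‹N.Normal›.conj_mem _ (N.pow_mem (z i).2 m) _
  have conj_val : ∀ (r γ : Γ) (i : Fin 2),
      Multiplicative.toAdd (ψ ⟨r * (γ⁻¹ * ((z i : N) : Γ) ^ m * γ) * r⁻¹, conj_mem r γ i⟩) = (m : ℤ) • val (r * γ⁻¹) i := by
    intro r γ i
    have e : (⟨r * (γ⁻¹ * ((z i : N) : Γ) ^ m * γ) * r⁻¹, conj_mem r γ i⟩ : N) = MulAut.conjNormal (r * γ⁻¹) ((z i) ^ m) :=
      Subtype.ext (by rw [MulAut.conjNormal_apply, Subgroup.coe_pow]; group)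
    rw [e, toAdd_conjNormal_pow]
  -- (ii) uniqueness on the transversal: `r·y = a·r′` with `r y r⁻¹ ∈ N` forces `r′ = r`
  have uniq : ∀ {r r' : Γ}, r ∈ R → r' ∈ R → ∀ {a : N} {y : Γ} (hy : r * y * r⁻¹ ∈ N), r * y = (a : Γ) * r' →
      r' = r ∧ (a : Γ) = r * y * r⁻¹ := by
    intro r r' hr hr' a y hy h
    have h1 : ((⟨r * y * r⁻¹, hy⟩⁻¹ * a : N) : Γ) * r' = r := by
      rw [Subgroup.coe_mul, Subgroup.coe_inv, mul_assoc, ← h]; group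
    have h2 : r' = r := hRt r' hr' r hr _ h1
    refine ⟨h2, ?_⟩
    rw [h2] at h
    exact eq_mul_inv_of_mul_eq h.symm
  -- (iii) the parallelogram bound for `± m x`, `x ∈ V`
  have para_V : ∀ {x : Site 2}, x ∈ V → ∀ (s : ℤ), (s = 1 ∨ s = -1) →
      |MaxArea.det2 (s • ((m : ℤ) • x)) (b 1)| ≤ |MaxArea.det2 (b 0) (b 1)| ∧
        |MaxArea.det2 (b 0) (s • ((m : ℤ) • x))| ≤ |MaxArea.det2 (b 0) (b 1)| := by
    intro x hx s hs
    have hsabs : |s| = 1 := by rcases hs with rfl | rfl <;> simp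
    have e1 : MaxArea.det2 (s • ((m : ℤ) • x)) (b 1) = s * ((m : ℤ) * (m : ℤ) * MaxArea.det2 x v) := by
      rw [hb1, MaxArea.det2, MaxArea.det2]; simp only [Pi.smul_apply, smul_eq_mul]; ring
    have e2 : MaxArea.det2 (b 0) (s • ((m : ℤ) • x)) = s * ((m : ℤ) * (m : ℤ) * MaxArea.det2 u x) := by
      rw [hb0, MaxArea.det2, MaxArea.det2]; simp only [Pi.smul_apply, smul_eq_mul]; ring
    have hmm : (0 : ℤ) ≤ (m : ℤ) * (m : ℤ) := by positivity
    have key : ∀ t : ℤ, |s * ((m : ℤ) * (m : ℤ) * t)| = (m : ℤ) * (m : ℤ) * |t| := fun t => by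
      rw [abs_mul, hsabs, one_mul, abs_mul, abs_of_nonneg hmm]
    have hB : |MaxArea.det2 (b 0) (b 1)| = (m : ℤ) * (m : ℤ) * |MaxArea.det2 u v| := by rw [hdetb, abs_mul, abs_of_nonneg hmm]
    rw [e1, e2, key, key, hB]
    exact ⟨mul_le_mul_of_nonneg_left (hmax x hx v hv) hmm, mul_le_mul_of_nonneg_left (hmax u hu x hx) hmm⟩
  refine CayleyCosets.conj4_of_cosetLetters_maxArea S hSgen N R hRt hRc ψ b hb ?_ ?_ g
  · -- hlip
    intro r hr y hy a r' hr' h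
    rw [hS, Finset.mem_union, Finset.mem_union] at hy
    by_cases hyL : y ∈ L ∨ y⁻¹ ∈ L
    · -- a lamp letter or its inverse: value `± m · val`, inside the parallelogram by max-area
      obtain ⟨p, s, hs, hyp⟩ : ∃ (p : (Γ ⧸ N) × Fin 2) (s : ℤ), (s = 1 ∨ s = -1) ∧ y = (lampLetter p) ^ s := by
        rcases hyL with hyL | hyL
        · obtain ⟨p, hp⟩ := hLmem.1 hyL
          exact ⟨p, 1, Or.inl rfl, by rw [zpow_one, hp]⟩
        · obtain ⟨p, hp⟩ := hLmem.1 hyL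
          exact ⟨p, -1, Or.inr rfl, by rw [zpow_neg, zpow_one, hp, inv_inv]⟩
      have hyN : r * y * r⁻¹ ∈ N := by
        rw [hyp]
        rcases hs with rfl | rfl
        · rw [zpow_one]; exact conj_mem r _ _
        · rw [zpow_neg, zpow_one, show r * (lampLetter p)⁻¹ * r⁻¹ = (r * lampLetter p * r⁻¹)⁻¹ by group]
          exact N.inv_mem (conj_mem r _ _)
      obtain ⟨-, ha⟩ := uniq hr hr' hyN h
      have hval' : Multiplicative.toAdd (ψ a) = s • ((m : ℤ) • val (r * (p.1.out)⁻¹) p.2) := by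
        rcases hs with rfl | rfl
        · have e : a = ⟨r * lampLetter p * r⁻¹, conj_mem r _ _⟩ := Subtype.ext (by rw [ha, hyp, zpow_one])
          rw [e, conj_val, one_smul]
        · have e : a = ⟨r * lampLetter p * r⁻¹, conj_mem r _ _⟩⁻¹ :=
            Subtype.ext (by rw [Subgroup.coe_inv, ha, hyp, zpow_neg, zpow_one]; group)
          rw [e, map_inv, toAdd_inv, conj_val, neg_one_smul]
      rw [hval']
      exact para_V (hVmem _ _) s hs
    · -- an `S₀`-letter: its value lies in `W₀`, and `m` dominates
      have hy₀ : y ∈ S₀ ∨ y⁻¹ ∈ S₀ := by tauto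
      have haN : r * y * r'⁻¹ ∈ N := by
        rw [show r * y * r'⁻¹ = (a : Γ) by rw [h, mul_inv_cancel_right]]; exact a.2
      have hw : Multiplicative.toAdd (ψ a) ∈ W₀ := by
        rw [hW₀, Finset.mem_image]
        refine ⟨(r, r', y), ?_, ?_⟩
        · refine Finset.mk_mem_product hr (Finset.mk_mem_product hr' ?_)
          rcases hy₀ with hy₀ | hy₀
          · exact Finset.mem_union_left _ hy₀
          · exact Finset.mem_union_right _ (Finset.mem_image.2 ⟨y⁻¹, hy₀, inv_inv y⟩)
        · have e : a = ⟨r * y * r'⁻¹, haN⟩ := Subtype.ext (eq_mul_inv_of_mul_eq h.symm)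
          change (if h : r * y * r'⁻¹ ∈ N then Multiplicative.toAdd (ψ ⟨_, h⟩) else 0) = Multiplicative.toAdd (ψ a)
          rw [dif_pos haN, e]
      obtain ⟨hw1, hw2⟩ := hmW _ hw
      set w := Multiplicative.toAdd (ψ a) with hw'
      have hmm : (0 : ℤ) ≤ (m : ℤ) := by positivity
      have hD : (1 : ℤ) ≤ |MaxArea.det2 u v| := Int.one_le_abs huv
      have e1 : MaxArea.det2 w (b 1) = (m : ℤ) * MaxArea.det2 w v := by
        rw [hb1, MaxArea.det2, MaxArea.det2]; simp only [Pi.smul_apply, smul_eq_mul]; ring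
      have e2 : MaxArea.det2 (b 0) w = (m : ℤ) * MaxArea.det2 u w := by
        rw [hb0, MaxArea.det2, MaxArea.det2]; simp only [Pi.smul_apply, smul_eq_mul]; ring
      have hw1' : |MaxArea.det2 w v| ≤ (m : ℤ) := by rw [Int.abs_eq_natAbs]; exact_mod_cast hw1
      have hw2' : |MaxArea.det2 u w| ≤ (m : ℤ) := by rw [Int.abs_eq_natAbs]; exact_mod_cast hw2
      rw [e1, e2, hdetb, abs_mul, abs_mul, abs_mul, abs_mul, abs_of_nonneg hmm]
      constructor
      · calc (m : ℤ) * |MaxArea.det2 w v| ≤ (m : ℤ) * (m : ℤ) := mul_le_mul_of_nonneg_left hw1' hmm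
          _ = (m : ℤ) * (m : ℤ) * 1 := (mul_one _).symm
          _ ≤ (m : ℤ) * (m : ℤ) * |MaxArea.det2 u v| := mul_le_mul_of_nonneg_left hD (by positivity)
      · calc (m : ℤ) * |MaxArea.det2 u w| ≤ (m : ℤ) * (m : ℤ) := mul_le_mul_of_nonneg_left hw2' hmm
          _ = (m : ℤ) * (m : ℤ) * 1 := (mul_one _).symm
          _ ≤ (m : ℤ) * (m : ℤ) * |MaxArea.det2 u v| := mul_le_mul_of_nonneg_left hD (by positivity)
  · -- hstep: at `r`, axis `i`, sign `σ`, the letter `γ⁻¹ (z jᵢ)^m γ` with `γ ∈ δᵢ⁻¹ r N` (resp. its inverse)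
    intro r hr i σ
    -- the coset datum of axis `i`
    obtain ⟨δ, j, hδ⟩ : ∃ (δ : Γ) (j : Fin 2), (m : ℤ) • val δ j = b i := by
      fin_cases i
      · exact ⟨δ₀, i₀, by rw [hδ₀]; rfl⟩
      · exact ⟨δ₁, i₁, by rw [hδ₁]; rfl⟩
    set q : Γ ⧸ N := QuotientGroup.mk (δ⁻¹ * r) with hq
    obtain ⟨h, hh⟩ := QuotientGroup.mk_out_eq_mul N (δ⁻¹ * r)
    -- `r q.out⁻¹ = δ · n` with `n ∈ N`
    have hn : ∃ n : Γ, n ∈ N ∧ r * (q.out)⁻¹ = δ * n := by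
      refine ⟨δ⁻¹ * (r * (q.out)⁻¹), ?_, by rw [mul_inv_cancel_left]⟩
      rw [hq, hh]
      have e : δ⁻¹ * (r * (δ⁻¹ * r * (h : Γ))⁻¹) = (δ⁻¹ * r) * (h : Γ)⁻¹ * (δ⁻¹ * r)⁻¹ := by group
      rw [e]
      exact ‹N.Normal›.conj_mem _ (N.inv_mem h.2) _
    obtain ⟨n, hnN, hrq⟩ := hn
    have hvq : val (r * (q.out)⁻¹) j = val δ j := by rw [hrq, hval δ hnN]
    let x : Γ := lampLetter (q, j)
    have hxL : x ∈ L := hLmem.2 ⟨(q, j), rfl⟩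
    have hxS : x ∈ S := Finset.mem_union_right _ hxL
    -- the `N`-element `r x r⁻¹` and its value
    let a₀ : N := ⟨r * x * r⁻¹, conj_mem r _ _⟩
    have ha₀ : Multiplicative.toAdd (ψ a₀) = b i := by
      change Multiplicative.toAdd (ψ ⟨r * (lampLetter (q, j)) * r⁻¹, conj_mem r _ _⟩) = b i
      rw [conj_val, hvq, hδ]
    rcases Int.units_eq_one_or σ with rfl | rfl
    · refine ⟨x, Or.inl hxS, a₀, r, hr, ?_, by rw [ha₀, Units.val_one, one_smul]⟩
      change r * x = r * x * r⁻¹ * r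
      rw [inv_mul_cancel_right]
    · refine ⟨x⁻¹, Or.inr (by rw [inv_inv]; exact hxS), a₀⁻¹, r, hr, ?_, ?_⟩
      · change r * x⁻¹ = (r * x * r⁻¹ : Γ)⁻¹ * r
        group
      · rw [map_inv, toAdd_inv, ha₀, Units.val_neg, Units.val_one, neg_one_smul]

/-! ## §4 The theorem for an arbitrary finite-index subgroup -/

/-- **THEOREM (UNCONDITIONAL): EVERY FINITELY GENERATED GROUP THAT VIRTUALLY MAPS ONTO A RANK-TWO SUBGROUP OF `ℤ²` HAS CAYLEY GRAPHS WITH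
`p_c < 1` AND `θ(p_c) = 0` — COFINALLY MANY GENERATING SETS.**  `A ≤ Γ` of finite index, `ψ : A → ℤ²` with two independent values, `S₀` any finite generating
set ⟹ a finite generating `S ⊇ S₀` with `p_c(Cay(Γ;S)) < 1` and `θ_g(p_c) = 0` at every `g`.  (Reduction to the normal core: `ψ` restricted to `core(A)` keeps
rank two because `a^{[Γ : core A]} ∈ core(A)`.)  What depends on the generating set is our proof, not — conjecturally — the truth; the lane's U_s gives
EVERY generating set when `b₁(Γ) ≥ 2`.  builds on p205010 (kernel theorem, internal audit signed; external expert review pending).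
[cite: BenjaminiSchramm1996, Conj. 4; §2 (Cayley graphs)] [cite: KozmaNitzan2024, §4 p. 16 (Lemma 8: max-area coordinates)] -/
theorem exists_gens_conj4 (A : Subgroup Γ) [A.FiniteIndex] (ψ : A →* Multiplicative (Site 2))
    (hrank : ∃ a b : A, MaxArea.det2 (Multiplicative.toAdd (ψ a)) (Multiplicative.toAdd (ψ b)) ≠ 0) (S₀ : Finset Γ)
    (hS₀ : Subgroup.closure (↑S₀ : Set Γ) = ⊤) :
    ∃ S : Finset Γ, S₀ ⊆ S ∧ Subgroup.closure (↑S : Set Γ) = ⊤ ∧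
      ∀ g : Γ, criticalProb (mulCayley (↑S : Set Γ)) g < 1 ∧ theta (mulCayley (↑S : Set Γ)) g (criticalProbIOf (mulCayley (↑S : Set Γ)) g) = 0 := by
  obtain ⟨a, b, hab⟩ := hrank
  -- the normal core and the restricted character
  let N : Subgroup Γ := A.normalCore
  have hNA : N ≤ A := Subgroup.normalCore_le A
  let ψN : N →* Multiplicative (Site 2) := ψ.comp (Subgroup.inclusion hNA)
  -- powers of `a, b` in the core
  let k : ℕ := N.index
  have hk : k ≠ 0 := Subgroup.FiniteIndex.index_ne_zero
  have hak : (a : Γ) ^ k ∈ N := N.pow_index_mem (a : Γ)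
  have hbk : (b : Γ) ^ k ∈ N := N.pow_index_mem (b : Γ)
  let z : Fin 2 → N := fun i => if i = 0 then ⟨(a : Γ) ^ k, hak⟩ else ⟨(b : Γ) ^ k, hbk⟩
  have hz0 : Multiplicative.toAdd (ψN (z 0)) = (k : ℤ) • Multiplicative.toAdd (ψ a) := by
    have e : Subgroup.inclusion hNA (z 0) = a ^ k := Subtype.ext (by simp [z])
    change Multiplicative.toAdd (ψ (Subgroup.inclusion hNA (z 0))) = _
    rw [e, map_pow, toAdd_pow, natCast_zsmul]
  have hz1 : Multiplicative.toAdd (ψN (z 1)) = (k : ℤ) • Multiplicative.toAdd (ψ b) := by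
    have e : Subgroup.inclusion hNA (z 1) = b ^ k := Subtype.ext (by simp [z])
    change Multiplicative.toAdd (ψ (Subgroup.inclusion hNA (z 1))) = _
    rw [e, map_pow, toAdd_pow, natCast_zsmul]
  have hz : MaxArea.det2 (Multiplicative.toAdd (ψN (z 0))) (Multiplicative.toAdd (ψN (z 1))) ≠ 0 := by
    rw [hz0, hz1, MaxArea.det2]
    have e : ((k : ℤ) • Multiplicative.toAdd (ψ a)) 0 * ((k : ℤ) • Multiplicative.toAdd (ψ b)) 1 -
        ((k : ℤ) • Multiplicative.toAdd (ψ a)) 1 * ((k : ℤ) • Multiplicative.toAdd (ψ b)) 0 =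
        (k : ℤ) * (k : ℤ) * MaxArea.det2 (Multiplicative.toAdd (ψ a)) (Multiplicative.toAdd (ψ b)) := by
      rw [MaxArea.det2]; simp only [Pi.smul_apply, smul_eq_mul]; ring
    rw [e]
    have hk' : (k : ℤ) ≠ 0 := by exact_mod_cast hk
    exact mul_ne_zero (mul_ne_zero hk' hk') hab
  exact exists_gens_conj4_of_normal N ψN z hz S₀ hS₀

/-- **Two-character form**: a finite-index `A ≤ Γ` with homomorphisms `ψ₀, ψ₁ : A → ℤ` independent on a pair `(a, b)` ⟹ some finite generating `S ⊇ S₀`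
with `p_c(Cay(Γ;S)) < 1 ∧ θ_g(p_c) = 0` at every vertex. builds on p205010 (kernel theorem, internal audit signed; external expert review pending).
[cite: BenjaminiSchramm1996, Conj. 4; §2 (Cayley graphs)] -/
theorem exists_gens_conj4_of_two_characters (A : Subgroup Γ) [A.FiniteIndex] (ψ₀ ψ₁ : A →* Multiplicative ℤ) (a b : A)
    (hind : Multiplicative.toAdd (ψ₀ a) * Multiplicative.toAdd (ψ₁ b) ≠ Multiplicative.toAdd (ψ₁ a) * Multiplicative.toAdd (ψ₀ b))
    (S₀ : Finset Γ) (hS₀ : Subgroup.closure (↑S₀ : Set Γ) = ⊤) :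
    ∃ S : Finset Γ, S₀ ⊆ S ∧ Subgroup.closure (↑S : Set Γ) = ⊤ ∧
      ∀ g : Γ, criticalProb (mulCayley (↑S : Set Γ)) g < 1 ∧ theta (mulCayley (↑S : Set Γ)) g (criticalProbIOf (mulCayley (↑S : Set Γ)) g) = 0 := by
  -- the pair character `(ψ₀, ψ₁) : A → ℤ²`
  let ψ : A →* Multiplicative (Site 2) :=
    { toFun := fun x => Multiplicative.ofAdd fun i => if i = 0 then Multiplicative.toAdd (ψ₀ x) else Multiplicative.toAdd (ψ₁ x)
      map_one' := by ext i; fin_cases i <;> simp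
      map_mul' := fun x y => by
        rw [← ofAdd_add]; congr 1; funext i
        fin_cases i <;> simp [toAdd_mul] }
  refine exists_gens_conj4 A ψ ⟨a, b, ?_⟩ S₀ hS₀
  change MaxArea.det2 (fun i => if i = 0 then Multiplicative.toAdd (ψ₀ a) else Multiplicative.toAdd (ψ₁ a))
    (fun i => if i = 0 then Multiplicative.toAdd (ψ₀ b) else Multiplicative.toAdd (ψ₁ b)) ≠ 0
  rw [MaxArea.det2]
  simp only [if_neg (by decide : (1 : Fin 2) ≠ 0)]
  exact sub_ne_zero.2 hind

end CayleyVirtualRank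

end Summit.CriticalPhenomena.PercolationContinuityZ3.Theorems.Transplant

end
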